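import Mathlib
import Literature.Barriers.NavierStokesRegularity.DyadicInvariantRegion
import Literature.Analysis.ODE.MaximalTime
import HarnessLib

/-!
# A three-window invariant region for the rescaled Katz–Pavlović chain (abstract first-exit lemma)
(helper file for crux stmt-NavierStokesRegularity-27057 `SubOnsagerCeiling.ForwardTailCeilingKP`, `--supports`)

**Abstract statement (`invariantRegionCut_le_one_of_tail`).** `Y₀ ≡ 0`; continuous non-negative
`Y₁, Y₂, …` on `[0, s]` with right derivatives `Ẏₙ = -κₙYₙ + Fₙ(Y²_{n-1} - pYₙY_{n+1})` on `[0, s)`,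
`0 < κₙ ≤ κ_{n+1} ≤ 4κₙ`, `0 < Fₙ`, `F_{n+1} = LFₙ`. Constraints, for every `n ≥ 1`: (R) `Yₙ ≤ 1`;
(T) `Y_{n+1} ≤ g(Yₙ)`, `g(x) = θ₀ + m₁x + m₂x²`; (B) `h(Yₙ) ≤ Y_{n+1}`, `h(x) = c((x-1/10)/(9/10))⁴`
for `x > 1/10`, `0` otherwise (the Barbato–Morandin–Romito lower curve); (C) the THREE-WINDOW
linear cut `a·Yₙ - b₁·Y_{n+1} + Y_{n+2} ≤ d`. If the four "inward pointing" inequalities hold in the abstract polynomial form of the hypotheses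
`hT`, `hB`, `hC` (and `p·c ≥ 1` for (R)), if the small box is admissible (`θ₀ ≥ 1/10`,
`a/10 + 1/10 ≤ d`, …), if `Yₙ(0) ≤ 1/10` for all `n` and the TAIL is quiescent (`Yₙ ≤ 1/10` on
`[0, s]` for `n ≥ K`), then `Yₙ(t) ≤ 1` for all `n` and `t ∈ [0, s]`.

This is the first-exit argument of BMR 2011, Lemma 2.1 (tree: `Dyadic.invariantRegion_le_one`;
`b ∈ [1.7, 2]` re-tuning `DyadicRange.invariantRegion_le_one_of_tail`) with ONE MORE constraint
family, the linear three-window cut (C): a deep zig-zag `(Y_{n-1}, Yₙ, Y_{n+1}) ≈ (1, x, h(x))` with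
a large `Y_{n+2}` is what breaks every two-window region below `p ≈ 1.6`; the cut caps `Y_{n+2}`
by `d - aYₙ + b₁Y_{n+1}` and is itself inward pointing. The numerical template (scale ratios
`b ∈ [81/50, 43/25]`) lives in the sibling `SubOnsagerCeilingDyadicMidRange*` files; this file is
template-agnostic (all inequalities are hypotheses).

HONEST FRAMING: abstract ODE lemma towards a MODEL-lattice statement (rung under crux `ForwardTailCeilingKP`,
route SubOnsagerCeiling, TL-M2Break); nothing here bears on Navier–Stokes regularity.
[cite: BarbatoMorandinRomito2011, §2 Lemma 2.1 and its proof]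
-/

noncomputable section

-- the sub-problem namespace `NavierStokesRegularity.NavierStokesRegularity` is the tree's layout (D-0017)
set_option linter.dupNamespace false

namespace Summit.NavierStokesRegularity.NavierStokesRegularity.Theorems.DyadicMidRange

open Set Filter Topology
open Literature.Barriers.NavierStokesRegularity.Dyadic

/-- `h(x) ≤ y` in polynomial form for the BMR lower curve `h(x) = c((x-1/10)/(9/10))⁴`
(`x > 1/10`), `0` (`x ≤ 1/10`): either `x ≤ 1/10`, or `c·u(x)⁴ ≤ y`.
[cite: BarbatoMorandinRomito2011, §2 (definition of `h`)] -/
theorem lowerCurve_le_iff_or {c x y : ℝ} (hy : 0 ≤ y) :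
    (if x ≤ 1 / 10 then (0 : ℝ) else c * ((x - 1 / 10) / (9 / 10)) ^ 4) ≤ y ↔
      (x ≤ 1 / 10 ∨ c * ((x - 1 / 10) / (9 / 10)) ^ 4 ≤ y) := by
  by_cases hx : x ≤ 1 / 10
  · rw [if_pos hx]; exact ⟨fun _ => Or.inl hx, fun _ => hy⟩
  · rw [if_neg hx]
    exact ⟨fun h => Or.inr h, fun h => h.resolve_left hx⟩

/-- The lower curve vanishes on `(-∞, 1/10]`. [cite: BarbatoMorandinRomito2011, §2 (definition of `h`)] -/
theorem lowerCurve_of_le {c x : ℝ} (hx : x ≤ 1 / 10) :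
    (if x ≤ 1 / 10 then (0 : ℝ) else c * ((x - 1 / 10) / (9 / 10)) ^ 4) = 0 := by
  rw [if_pos hx]

/-- **Three-window invariant region on an infinite chain with a quiescent tail** (see the module
docstring). The inward-pointing facts are the hypotheses `hpc` (right piece), `hT` (upper curve),
`hB` (lower curve, curved part) and `hC` (the cut); `hC0` says that the cut below the datum shell
(`Y₀ = 0`) follows from (T). [cite: BarbatoMorandinRomito2011, §2 Lemma 2.1] -/
theorem invariantRegionCut_le_one_of_tail {Y : ℕ → ℝ → ℝ} {κ F : ℕ → ℝ}
    {L p c s θ₀ m₁ m₂ a b₁ d : ℝ} {K : ℕ}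
    (hs : 0 < s)
    (hκ : ∀ n, 0 < κ n) (hκmono : ∀ n, κ n ≤ κ (n + 1)) (hκ4 : ∀ n, κ (n + 1) ≤ 4 * κ n)
    (hF : ∀ n, 0 < F n) (hFL : ∀ n, F (n + 1) = L * F n)
    (_hc : 0 ≤ c) (hpc : 1 ≤ p * c) (hp : 0 ≤ p)
    (hθ₀ : 1 / 10 ≤ θ₀) (hm : ∀ x, 0 ≤ x → x ≤ 1 → 0 ≤ m₁ + m₂ * x) (ha : 0 ≤ a) (hb₁ : 0 ≤ b₁)
    (hd : a / 10 + 1 / 10 ≤ d)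
    (hC0 : ∀ x y : ℝ, 0 ≤ x → x ≤ 1 → 0 ≤ y → y ≤ θ₀ + m₁ * x + m₂ * x ^ 2 → -b₁ * x + y ≤ d)
    -- (T) inward pointing on `y = g(x)`
    (hT : ∀ κ0 κ1 Fn x w z : ℝ, 0 < κ0 → κ0 ≤ κ1 → 0 < Fn → 0 ≤ x → x ≤ 1 →
      (θ₀ + m₁ * x + m₂ * x ^ 2) ≤ 1 → 0 ≤ w → w ≤ 1 → 0 ≤ z → z ≤ 1 →
      c * (((θ₀ + m₁ * x + m₂ * x ^ 2) - 1 / 10) / (9 / 10)) ^ 4 ≤ z →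
      (-κ1 * (θ₀ + m₁ * x + m₂ * x ^ 2) + L * Fn * (x ^ 2 - p * (θ₀ + m₁ * x + m₂ * x ^ 2) * z)) -
        (m₁ + 2 * m₂ * x) * (-κ0 * x + Fn * (w ^ 2 - p * x * (θ₀ + m₁ * x + m₂ * x ^ 2))) < 0)
    -- (B) inward pointing on the curved piece `y = c·u(x)⁴`, `x > 1/10`
    (hB : ∀ κ0 κ1 Fn x y z w : ℝ, 0 < κ0 → κ1 ≤ 4 * κ0 → 0 < Fn → 1 / 10 < x → x ≤ 1 →
      y = c * ((x - 1 / 10) / (9 / 10)) ^ 4 → 0 ≤ z → z ≤ 1 → z ≤ θ₀ + m₁ * y + m₂ * y ^ 2 →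
      a * x - b₁ * y + z ≤ d → 0 ≤ w → w ≤ 1 →
      4 * c * ((x - 1 / 10) / (9 / 10)) ^ 3 / (9 / 10) * (-κ0 * x + Fn * (w ^ 2 - p * x * y)) -
        (-κ1 * y + L * Fn * (x ^ 2 - p * y * z)) < 0)
    -- (C) inward pointing on the cut `a x - b₁ y + z = d`
    (hC : ∀ κ0 κ1 κ2 Fn w x y z v : ℝ, 0 < κ0 → κ0 ≤ κ1 → κ1 ≤ κ2 → κ1 ≤ 4 * κ0 →
      κ2 ≤ 4 * κ1 → 0 < Fn → 0 ≤ w → w ≤ 1 → 0 ≤ x → x ≤ 1 → 0 ≤ y → y ≤ 1 → 0 ≤ z → z ≤ 1 →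
      0 ≤ v → v ≤ 1 → a * x - b₁ * y + z = d →
      (w ≤ 1 / 10 ∨ c * ((w - 1 / 10) / (9 / 10)) ^ 4 ≤ x) → a * w - b₁ * x + y ≤ d →
      (x ≤ 1 / 10 ∨ c * ((x - 1 / 10) / (9 / 10)) ^ 4 ≤ y) → y ≤ θ₀ + m₁ * x + m₂ * x ^ 2 →
      (y ≤ 1 / 10 ∨ c * ((y - 1 / 10) / (9 / 10)) ^ 4 ≤ z) → z ≤ θ₀ + m₁ * y + m₂ * y ^ 2 →
      (z ≤ 1 / 10 ∨ c * ((z - 1 / 10) / (9 / 10)) ^ 4 ≤ v) →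
      a * (-κ0 * x + Fn * (w ^ 2 - p * x * y)) - b₁ * (-κ1 * y + L * Fn * (x ^ 2 - p * y * z)) +
        (-κ2 * z + L * L * Fn * (y ^ 2 - p * z * v)) < 0)
    (hY0 : ∀ t, Y 0 t = 0)
    (hcont : ∀ n, ContinuousOn (Y n) (Icc 0 s))
    (hderiv : ∀ n, 1 ≤ n → ∀ t ∈ Ico 0 s,
      HasDerivWithinAt (Y n) (-κ n * Y n t + F n * (Y (n - 1) t ^ 2 - p * Y n t * Y (n + 1) t))
        (Ici t) t)
    (hpos : ∀ n, ∀ t ∈ Icc 0 s, 0 ≤ Y n t)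
    (hinit : ∀ n, Y n 0 ≤ 1 / 10)
    (htail : ∀ n, K ≤ n → ∀ t ∈ Icc 0 s, Y n t ≤ 1 / 10) :
    ∀ n, ∀ t ∈ Icc 0 s, Y n t ≤ 1 := by
  set h : ℝ → ℝ := fun x => if x ≤ 1 / 10 then (0 : ℝ) else c * ((x - 1 / 10) / (9 / 10)) ^ 4 with hh
  set g : ℝ → ℝ := fun x => θ₀ + m₁ * x + m₂ * x ^ 2 with hg
  have hg_ge : ∀ x, 0 ≤ x → x ≤ 1 → 1 / 10 ≤ g x := by
    intro x hx0 hx1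
    have := hm x hx0 hx1
    have e : g x = θ₀ + x * (m₁ + m₂ * x) := by simp only [hg]; ring
    rw [e]; nlinarith
  have hg_cont : Continuous g := by
    have : g = fun x => θ₀ + m₁ * x + m₂ * x ^ 2 := rfl
    rw [this]; fun_prop
  have hg_deriv : ∀ x, HasDerivAt g (m₁ + 2 * m₂ * x) x := by
    intro x
    have h1 : HasDerivAt (fun x : ℝ => m₁ * x + m₂ * x ^ 2) (m₁ * 1 + m₂ * (↑2 * x ^ (2 - 1) * 1)) x :=
      ((hasDerivAt_id' x).const_mul m₁).add (((hasDerivAt_id' x).pow 2).const_mul m₂)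
    have h2 := h1.const_add θ₀
    have e : (fun x : ℝ => θ₀ + (m₁ * x + m₂ * x ^ 2)) = g := by
      funext y; simp only [hg]; ring
    rw [e] at h2
    refine h2.congr_deriv ?_
    push_cast; ring
  -- the constraint predicate (only the first `K` windows can be active)
  set P : ℝ → Prop := fun t =>
    (∀ n ∈ Finset.Icc 1 K, Y n t ≤ 1) ∧
      (∀ n ∈ Finset.Icc 1 K, Y (n + 1) t ≤ g (Y n t)) ∧
      (∀ n ∈ Finset.Icc 1 K, h (Y n t) ≤ Y (n + 1) t) ∧
      (∀ n ∈ Finset.Icc 1 K, a * Y n t - b₁ * Y (n + 1) t + Y (n + 2) t ≤ d) with hP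
  -- all four constraint families hold for EVERY `n ≥ 1` once `P t` holds (tail windows are small)
  have hsmall : ∀ t ∈ Icc (0 : ℝ) s, P t →
      (∀ n, Y n t ≤ 1) ∧ (∀ n, 1 ≤ n → Y (n + 1) t ≤ g (Y n t)) ∧
        (∀ n, 1 ≤ n → h (Y n t) ≤ Y (n + 1) t) ∧
        (∀ n, 1 ≤ n → a * Y n t - b₁ * Y (n + 1) t + Y (n + 2) t ≤ d) := by
    intro t ht hPt
    simp only [hP] at hPt
    obtain ⟨hR, hTt, hBt, hCt⟩ := hPt
    have hle1 : ∀ n, Y n t ≤ 1 := by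
      intro n
      rcases Nat.eq_zero_or_pos n with rfl | hn1
      · rw [hY0]; norm_num
      rcases le_or_gt K n with hKn | hnK
      · linarith [htail n hKn t ht]
      · exact hR n (Finset.mem_Icc.2 ⟨hn1, hnK.le⟩)
    refine ⟨hle1, fun n hn1 => ?_, fun n hn1 => ?_, fun n hn1 => ?_⟩
    · rcases le_or_gt n K with hnK | hKn
      · exact hTt n (Finset.mem_Icc.2 ⟨hn1, hnK⟩)
      · have h1 := htail (n + 1) (by omega) t ht
        exact h1.trans (hg_ge _ (hpos n t ht) (hle1 n))
    · rcases le_or_gt n K with hnK | hKn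
      · exact hBt n (Finset.mem_Icc.2 ⟨hn1, hnK⟩)
      · have h1 := htail n hKn.le t ht
        simp only [hh]; rw [lowerCurve_of_le h1]; exact hpos (n + 1) t ht
    · rcases le_or_gt n K with hnK | hKn
      · exact hCt n (Finset.mem_Icc.2 ⟨hn1, hnK⟩)
      · have h1 := htail n hKn.le t ht
        have h2 := htail (n + 2) (by omega) t ht
        have h3 := hpos (n + 1) t ht
        have h4 := hpos n t ht
        nlinarith
  suffices key : ∀ t ∈ Icc 0 s, P t by
    intro n t ht
    exact (hsmall t ht (key t ht)).1 n
  -- `P 0`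
  have hP0 : P 0 := by
    have h0s : (0 : ℝ) ∈ Icc 0 s := ⟨le_rfl, hs.le⟩
    simp only [hP]
    refine ⟨fun n _ => ?_, fun n _ => ?_, fun n _ => ?_, fun n _ => ?_⟩
    · linarith [hinit n]
    · have h1 := hinit (n + 1)
      have := hg_ge (Y n 0) (hpos n 0 h0s) (by linarith [hinit n])
      linarith
    · simp only [hh]; rw [lowerCurve_of_le (hinit n)]; exact hpos (n + 1) 0 h0s
    · have h1 := hinit n
      have h2 := hinit (n + 2)
      have h3 := hpos (n + 1) 0 h0s
      have h4 := hpos n 0 h0s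
      nlinarith
  -- the constraints are closed
  have hclosed : ∀ t ∈ Ioc 0 s, (∀ r ∈ Ico 0 t, P r) → P t := by
    intro t ht hPs
    simp only [hP] at hPs ⊢
    refine ⟨fun n hn => ?_, fun n hn => ?_, fun n hn => ?_, fun n hn => ?_⟩
    · exact le_of_forall_Ico_le (hcont n) continuousOn_const ht fun r hr => (hPs r hr).1 n hn
    · exact le_of_forall_Ico_le (hcont (n + 1)) (hg_cont.comp_continuousOn (hcont n)) ht
        fun r hr => (hPs r hr).2.1 n hn
    · exact le_of_forall_Ico_le ((continuous_lowerCurve c).comp_continuousOn (hcont n))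
        (hcont (n + 1)) ht fun r hr => (hPs r hr).2.2.1 n hn
    · exact le_of_forall_Ico_le
        ((((continuousOn_const.mul (hcont n)).sub (continuousOn_const.mul (hcont (n + 1)))).add
          (hcont (n + 2))))
        continuousOn_const ht fun r hr => (hPs r hr).2.2.2 n hn
  -- the maximal time
  set T := Literature.Analysis.ODE.maximalTimeP P 0 s with hTdef
  have hTmem : T ∈ Icc 0 s := Literature.Analysis.ODE.maximalTimeP_mem hs.le hP0
  have hPT : ∀ t ∈ Icc 0 T, P t := fun t ht =>
    Literature.Analysis.ODE.maximalTimeP_spec hs.le hP0 hclosed ht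
  by_contra hall
  have hTb : T < s := by
    rcases lt_or_eq_of_le hTmem.2 with hlt | heq
    · exact hlt
    · exact absurd (fun t ht => hPT t (heq ▸ ht)) hall
  have hT0 : 0 ≤ T := hTmem.1
  have hTs : T ∈ Icc 0 s := ⟨hT0, hTb.le⟩
  -- the state at time `T`: every constraint, every `n ≥ 1`
  obtain ⟨hle1, hupp, hlow, hcut⟩ := hsmall T hTs (hPT T ⟨hT0, le_rfl⟩)
  have hposT : ∀ k, 0 ≤ Y k T := fun k => hpos k T hTs
  -- polynomial forms of the lower constraint at `T`
  have hlow' : ∀ k, 1 ≤ k → (Y k T ≤ 1 / 10 ∨ c * ((Y k T - 1 / 10) / (9 / 10)) ^ 4 ≤ Y (k + 1) T) :=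
    fun k hk => (lowerCurve_le_iff_or (hposT (k + 1))).1 (hlow k hk)
  -- the cut one window below: holds also at `k = 0` (there `Y₀ = 0`)
  have hcut' : ∀ k, a * Y k T - b₁ * Y (k + 1) T + Y (k + 2) T ≤ d := by
    intro k
    rcases Nat.eq_zero_or_pos k with rfl | hk
    · rw [hY0, mul_zero, zero_sub]
      have := hC0 (Y 1 T) (Y 2 T) (hposT 1) (hle1 1) (hposT 2) (hupp 1 le_rfl)
      linarith
    · exact hcut k hk
  have hlow0 : ∀ k, (Y k T ≤ 1 / 10 ∨ c * ((Y k T - 1 / 10) / (9 / 10)) ^ 4 ≤ Y (k + 1) T) := by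
    intro k
    rcases Nat.eq_zero_or_pos k with rfl | hk
    · left; rw [hY0]; norm_num
    · exact hlow' k hk
  -- continuity within `[T, ∞)` at `T`
  have hnhds : Icc 0 s ∈ 𝓝[Ici T] T := Icc_mem_nhdsGE_of_mem ⟨hT0, hTb⟩
  have hcw : ∀ k, ContinuousWithinAt (Y k) (Ici T) T := fun k =>
    ((hcont k) T hTs).mono_of_mem_nhdsWithin hnhds
  -- derivatives at `T`
  have hd : ∀ k, 1 ≤ k → HasDerivWithinAt (Y k)
      (-κ k * Y k T + F k * (Y (k - 1) T ^ 2 - p * Y k T * Y (k + 1) T)) (Ici T) T :=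
    fun k hk1 => hderiv k hk1 T ⟨hT0, hTb⟩
  have hFL2 : ∀ n, F (n + 2) = L * L * F n := by
    intro n; rw [show n + 2 = (n + 1) + 1 from rfl, hFL, hFL]; ring
  -- (R) the constraints `Yₙ ≤ 1` persist
  have evR : ∀ n ∈ Finset.Icc 1 K, ∀ᶠ t in 𝓝[Ici T] T, Y n t ≤ 1 := by
    intro n hn
    obtain ⟨hn1, -⟩ := Finset.mem_Icc.1 hn
    rcases lt_or_eq_of_le (hle1 n) with hlt | heq
    · exact ((hcw n).eventually_lt_const hlt).mono fun t ht => ht.le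
    · have hφ := (hd n hn1).sub_const 1
      -- the upper neighbour is at least `c` (lower curve at `x = 1`)
      have hz : c ≤ Y (n + 1) T := by
        rcases hlow' n hn1 with h1 | h1
        · rw [heq] at h1; norm_num at h1
        · rw [heq] at h1; norm_num at h1; exact h1
      have hneg : -κ n * Y n T + F n * (Y (n - 1) T ^ 2 - p * Y n T * Y (n + 1) T) < 0 := by
        have h1 : Y (n - 1) T ^ 2 ≤ 1 := by
          have := hle1 (n - 1); have := hposT (n - 1); nlinarith
        have h2 : 1 ≤ p * Y (n + 1) T := le_trans hpc (mul_le_mul_of_nonneg_left hz hp)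
        have h3 : Y (n - 1) T ^ 2 - p * Y n T * Y (n + 1) T ≤ 0 := by rw [heq]; linarith
        have h4 : F n * (Y (n - 1) T ^ 2 - p * Y n T * Y (n + 1) T) ≤ 0 :=
          mul_nonpos_of_nonneg_of_nonpos (hF n).le h3
        have h5 : -κ n * Y n T < 0 := by rw [heq, mul_one]; linarith [hκ n]
        linarith
      exact (eventually_nonpos_of_hasDerivWithinAt_neg hφ hneg (by simp [heq])).mono
        fun t ht => by linarith
  -- (T) the constraints `Y_{n+1} ≤ g(Yₙ)` persist
  have evT : ∀ n ∈ Finset.Icc 1 K, ∀ᶠ t in 𝓝[Ici T] T, Y (n + 1) t ≤ g (Y n t) := by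
    intro n hn
    obtain ⟨hn1, -⟩ := Finset.mem_Icc.1 hn
    rcases lt_or_eq_of_le (hupp n hn1) with hlt | heq
    · have hc2 : ContinuousWithinAt (fun t => Y (n + 1) t - g (Y n t)) (Ici T) T :=
        (hcw (n + 1)).sub (hg_cont.continuousAt.comp_continuousWithinAt (hcw n))
      have hlt' : Y (n + 1) T - g (Y n T) < 0 := by linarith
      exact (hc2.eventually_lt_const hlt').mono fun t (ht : Y (n + 1) t - g (Y n t) < 0) => by linarith
    · have hdn := hd n hn1
      have hdn1 := hd (n + 1) (by omega)
      simp only [Nat.add_sub_cancel] at hdn1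
      have hchain := (hg_deriv (Y n T)).comp_hasDerivWithinAt T hdn
      have hφ := hdn1.sub hchain
      have hx0 : 0 ≤ Y n T := hposT n
      have hx1 : Y n T ≤ 1 := hle1 n
      have hy1 : g (Y n T) ≤ 1 := by rw [← heq]; exact hle1 (n + 1)
      have hz : c * ((g (Y n T) - 1 / 10) / (9 / 10)) ^ 4 ≤ Y (n + 1 + 1) T := by
        rcases hlow' (n + 1) (by omega) with h1 | h1
        · rw [heq] at h1
          have hgx : g (Y n T) = 1 / 10 := le_antisymm h1 (hg_ge _ hx0 hx1)
          rw [hgx]; norm_num; exact hposT (n + 1 + 1)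
        · rw [heq] at h1; exact h1
      have hneg : (-κ (n + 1) * Y (n + 1) T +
            F (n + 1) * (Y n T ^ 2 - p * Y (n + 1) T * Y (n + 1 + 1) T)) -
          (m₁ + 2 * m₂ * Y n T) * (-κ n * Y n T + F n * (Y (n - 1) T ^ 2 - p * Y n T * Y (n + 1) T)) < 0 := by
        rw [hFL n, heq]
        exact hT (κ n) (κ (n + 1)) (F n) (Y n T) (Y (n - 1) T) (Y (n + 1 + 1) T) (hκ n) (hκmono n)
          (hF n) hx0 hx1 hy1 (hposT (n - 1)) (hle1 (n - 1)) (hposT (n + 1 + 1)) (hle1 (n + 1 + 1)) hz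
      have h0 : Y (n + 1) T - g (Y n T) ≤ 0 := by rw [heq]; simp
      exact (eventually_nonpos_of_hasDerivWithinAt_neg hφ (by simpa [Function.comp] using hneg) h0).mono
        fun t (ht : Y (n + 1) t - g (Y n t) ≤ 0) => by linarith
  -- (B) the constraints `h(Yₙ) ≤ Y_{n+1}` persist
  have evB : ∀ n ∈ Finset.Icc 1 K, ∀ᶠ t in 𝓝[Ici T] T, h (Y n t) ≤ Y (n + 1) t := by
    intro n hn
    obtain ⟨hn1, -⟩ := Finset.mem_Icc.1 hn
    by_cases hxδ : Y n T < 1 / 10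
    · -- flat bottom piece: `h ≡ 0` and positivity
      have ev1 : ∀ᶠ t in 𝓝[Ici T] T, Y n t < 1 / 10 := (hcw n).eventually_lt_const hxδ
      have ev2 : ∀ᶠ t in 𝓝[Ici T] T, t ∈ Icc 0 s := by
        filter_upwards [hnhds] with t ht using ht
      filter_upwards [ev1, ev2] with t ht hts
      simp only [hh]; rw [lowerCurve_of_le ht.le]
      exact hpos (n + 1) t hts
    · push Not at hxδ
      rcases lt_or_eq_of_le (hlow n hn1) with hlt | heq
      · have hc2 : ContinuousWithinAt (fun t => h (Y n t) - Y (n + 1) t) (Ici T) T :=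
          (((continuous_lowerCurve c).continuousAt).comp_continuousWithinAt (hcw n)).sub (hcw (n + 1))
        have hlt' : h (Y n T) - Y (n + 1) T < 0 := by linarith
        exact (hc2.eventually_lt_const hlt').mono fun t ht => by linarith
      · -- active constraint
        have hdn := hd n hn1
        have hdn1 := hd (n + 1) (by omega)
        simp only [Nat.add_sub_cancel] at hdn1
        have hchain := (hasDerivAt_lowerCurve c (Y n T)).comp_hasDerivWithinAt T hdn
        have hφ := hchain.sub hdn1
        have h0 : h (Y n T) - Y (n + 1) T ≤ 0 := by rw [heq]; simp
        rcases eq_or_lt_of_le hxδ with hxeq | hxgt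
        · -- the corner `x = 1/10`: `h = h' = 0`, `Y_{n+1} = 0`
          have hy0 : Y (n + 1) T = 0 := by
            rw [← heq]; simp only [hh]; exact lowerCurve_of_le hxeq.symm.le
          have hneg : (if Y n T ≤ 1 / 10 then (0 : ℝ)
                else 4 * c * ((Y n T - 1 / 10) / (9 / 10)) ^ 3 / (9 / 10)) *
                (-κ n * Y n T + F n * (Y (n - 1) T ^ 2 - p * Y n T * Y (n + 1) T)) -
              (-κ (n + 1) * Y (n + 1) T +
                F (n + 1) * (Y n T ^ 2 - p * Y (n + 1) T * Y (n + 1 + 1) T)) < 0 := by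
            rw [if_pos hxeq.symm.le, hy0, ← hxeq]
            have := hF (n + 1)
            nlinarith
          exact (eventually_nonpos_of_hasDerivWithinAt_neg hφ hneg h0).mono fun t ht => by
            simpa [Function.comp, hh] using ht
        · -- `x > 1/10`: the curved piece, hypothesis `hB`
          have hy : Y (n + 1) T = c * ((Y n T - 1 / 10) / (9 / 10)) ^ 4 := by
            rw [← heq]; simp only [hh]; rw [if_neg (not_le.2 hxgt)]
          have hneg : (if Y n T ≤ 1 / 10 then (0 : ℝ)
                else 4 * c * ((Y n T - 1 / 10) / (9 / 10)) ^ 3 / (9 / 10)) *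
                (-κ n * Y n T + F n * (Y (n - 1) T ^ 2 - p * Y n T * Y (n + 1) T)) -
              (-κ (n + 1) * Y (n + 1) T +
                F (n + 1) * (Y n T ^ 2 - p * Y (n + 1) T * Y (n + 1 + 1) T)) < 0 := by
            rw [if_neg (not_le.2 hxgt), hFL n]
            exact hB (κ n) (κ (n + 1)) (F n) (Y n T) (Y (n + 1) T) (Y (n + 1 + 1) T) (Y (n - 1) T)
              (hκ n) (hκ4 n) (hF n) hxgt (hle1 n) hy (hposT (n + 1 + 1)) (hle1 (n + 1 + 1))
              (hupp (n + 1) (by omega)) (hcut' n) (hposT (n - 1)) (hle1 (n - 1))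
          exact (eventually_nonpos_of_hasDerivWithinAt_neg hφ hneg h0).mono fun t ht => by
            simpa [Function.comp, hh] using ht
  -- (C) the cuts `a Yₙ - b₁ Y_{n+1} + Y_{n+2} ≤ d` persist
  have evC : ∀ n ∈ Finset.Icc 1 K, ∀ᶠ t in 𝓝[Ici T] T,
      a * Y n t - b₁ * Y (n + 1) t + Y (n + 2) t ≤ d := by
    intro n hn
    obtain ⟨hn1, -⟩ := Finset.mem_Icc.1 hn
    rcases lt_or_eq_of_le (hcut n hn1) with hlt | heq
    · have hc2 : ContinuousWithinAt (fun t => a * Y n t - b₁ * Y (n + 1) t + Y (n + 2) t - d)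
          (Ici T) T :=
        (((continuousWithinAt_const.mul (hcw n)).sub (continuousWithinAt_const.mul (hcw (n + 1)))).add
          (hcw (n + 2))).sub continuousWithinAt_const
      have hlt' : a * Y n T - b₁ * Y (n + 1) T + Y (n + 2) T - d < 0 := by linarith
      exact (hc2.eventually_lt_const hlt').mono
        fun t (ht : a * Y n t - b₁ * Y (n + 1) t + Y (n + 2) t - d < 0) => by linarith
    · have hdn := hd n hn1
      have hdn1 := hd (n + 1) (by omega)
      have hdn2 := hd (n + 2) (by omega)
      simp only [Nat.add_sub_cancel] at hdn1
      simp only [show n + 2 - 1 = n + 1 by omega] at hdn2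
      have hφ := (((hdn.const_mul a).sub (hdn1.const_mul b₁)).add hdn2).sub_const d
      have hneg : a * (-κ n * Y n T + F n * (Y (n - 1) T ^ 2 - p * Y n T * Y (n + 1) T)) -
            b₁ * (-κ (n + 1) * Y (n + 1) T +
              F (n + 1) * (Y n T ^ 2 - p * Y (n + 1) T * Y (n + 1 + 1) T)) +
          (-κ (n + 2) * Y (n + 2) T +
            F (n + 2) * (Y (n + 1) T ^ 2 - p * Y (n + 2) T * Y (n + 2 + 1) T)) < 0 := by
        rw [hFL n, hFL2 n, show n + 1 + 1 = n + 2 by omega]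
        exact hC (κ n) (κ (n + 1)) (κ (n + 2)) (F n) (Y (n - 1) T) (Y n T) (Y (n + 1) T)
          (Y (n + 2) T) (Y (n + 2 + 1) T) (hκ n) (hκmono n) (hκmono (n + 1)) (hκ4 n) (hκ4 (n + 1))
          (hF n) (hposT (n - 1)) (hle1 (n - 1)) (hposT n) (hle1 n) (hposT (n + 1)) (hle1 (n + 1))
          (hposT (n + 2)) (hle1 (n + 2)) (hposT (n + 2 + 1)) (hle1 (n + 2 + 1)) heq
          (by
            have := hlow0 (n - 1)
            rwa [show n - 1 + 1 = n by omega] at this)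
          (by
            have := hcut' (n - 1)
            rwa [show n - 1 + 1 = n by omega, show n - 1 + 2 = n + 1 by omega] at this)
          (hlow0 n) (hupp n hn1)
          (hlow0 (n + 1)) (hupp (n + 1) (by omega))
          (by
            have := hlow0 (n + 2)
            rwa [show n + 2 + 1 = n + 2 + 1 from rfl] at this)
      have h0 : a * Y n T - b₁ * Y (n + 1) T + Y (n + 2) T - d ≤ 0 := by rw [heq]; simp
      exact (eventually_nonpos_of_hasDerivWithinAt_neg hφ (by simpa using hneg) h0).mono
        fun t (ht : a * Y n t - b₁ * Y (n + 1) t + Y (n + 2) t - d ≤ 0) => by linarith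
  -- exit: `P` holds eventually at `T` within `[0, s]`, contradicting `T < s`
  have hright : ∀ᶠ t in 𝓝[Ici T] T, P t := by
    have e1 := (Filter.eventually_all_finset _).2 evR
    have e2 := (Filter.eventually_all_finset _).2 evT
    have e3 := (Filter.eventually_all_finset _).2 evB
    have e4 := (Filter.eventually_all_finset _).2 evC
    filter_upwards [e1, e2, e3, e4] with t h1 h2 h3 h4
    simp only [hP]
    exact ⟨h1, h2, h3, h4⟩
  exact Literature.Analysis.ODE.not_eventually_of_maximalTimeP_lt hs.le hP0 hTb
    (eventually_nhdsWithin_Icc_of_left_of_right hPT hright)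

end Summit.NavierStokesRegularity.NavierStokesRegularity.Theorems.DyadicMidRange

end
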